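import Summits.BirchSwinnertonDyer.BirchSwinnertonDyer.Theorems.LambdaTransportDoorAtTwoLayerOne
import HarnessLib

/-!
# Cell bsd-rank2 (p2 GEN 61, part 2a): the MODULE ALGEBRA of Certificate C — a `ν₂`-torsion vector, `ν₂ = T² + 2T + 2`,
# exhausts the budget `λ ≤ 4`, `rank X/TX ≥ 2` and forces `T`-semisimplicity

Cell-side file (cell bsd-rank2, HOME `run/shared/lean/pub/bsd-rank2/`, seat bsd-rank2-p2 GEN 61; memo `p2/g61/GEN61.md` §6b;
namespace `Summit.BirchSwinnertonDyer.BirchSwinnertonDyer.Theorems.LambdaTransportDoorAtTwoLayerTwoAlgebra`). THEOREMS ONLY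
(no definition, no named fact, no instance, no `sorry`); pure algebra, no elliptic curve. Consumed by part 2b
`…Theorems.LambdaTransportDoorAtTwoLayerTwo` (Certificate C on the 8-15-17 family). Sequel of `…LayerOne` §1 (GEN 60).

THE POINT. In `Λ = ℤ_2⟦T⟧`, `ω₂ = (1+T)^4 − 1 = T · (T+2) · ν₂` with `ν₂ = T² + 2T + 2` (`omega_two_eq`), the factor cutting
out the second layer `ℚ_2 = ℚ(√(2+√2))` of the cyclotomic `ℤ_2`-extension; `ν₂` has no root in `ℚ_2` since `ν₂(c) = (c+1)² + 1`
and `−1` is not a square modulo `4` (`padicTwo_sq_ne_neg_one`, `padicTwo_nu_ne_zero`).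

* §1 (a field `K`, `2 ≠ 0`, `c² + 2c + 2` without root in `K`): for endomorphisms `A`, `N = A² + 2A + 2` of `V`, `dim V ≤ 4`,
  `dim ker A ≥ 2`, `ker N ≠ 0` ⟹ `V = ker A ⊕ ker N` (`2 + 2`): `ker A² = ker A`, `dim ker A = 2`, `ker (A+2) = 0`, `dim V = 4`,
  `dim ker N = 2` (`layerTwo_linearAlgebra`). Coprime kernels add (`finrank_ker_aeval_mul_of_isCoprime`); `T(T+2)` and `ν₂`
  are coprime (`isCoprime_omega_one_nu_two`, Bezout `ν₂ − T(T+2) = 2`).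
* §3 (`Λ = ℤ_p⟦T⟧`, any prime `p` at which `ν₂` has no root in `ℚ_p`): for a finitely generated torsion `Λ`-module `X` with
  `λ(X) ≤ 4`, `rank_{ℤ_p} X/TX ≥ 2`, `rank_{ℤ_p} X/ν₂X ≥ 1`: `T` acts semisimply on `ℚ_p ⊗ X`, `rank X/TX = 2`, `λ(X) = 4`,
  `rank X/(T+2)X = 0`, `rank X/ν₂X = 2` (`layerTwo_module`, via `…LayerOne.lambdaInvariant_quotient_eq_finrank_ker`); and
  `rank X/T(T+2)ν₂X = rank X/T(T+2)X + rank X/ν₂X` (`lambdaInvariant_quotient_omega_one_mul_nu_two`).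

B1 honesty (director-bsd 2026-08-27): module algebra only; BSD is not touched; S0 does not move. PARTITION: none (algebra for
the r_an ≥ 2 cell, summit axis S0); TWIN (D-0056): n/a.

References: L. Washington, GTM 83 (1997) §13.1–13.2 (`ω_n`, Prop. 13.8, Thm. 13.12) [Washington1997]; R. Greenberg, LNM 1716
(1999) Thm. 1.2, §1 p. 65, Conj. 1.12 [GreenbergLNM1716].
-/

set_option linter.dupNamespace false

noncomputable section

open scoped MatrixGroups ModularForm TensorProduct
open PowerSeries CongruenceSubgroup WeierstrassCurve Literature.NumberTheory.EllipticCurves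
  Literature.NumberTheory.EllipticCurves.ModularForms
  Literature.NumberTheory.EllipticCurves.IwasawaAlgebra
  Literature.NumberTheory.EllipticCurves.Rank1Residual
  Literature.NumberTheory.EllipticCurves.Rank1Residual.Typed
  Literature.NumberTheory.EllipticCurves.Greenberg1999

universe u

namespace Summit.BirchSwinnertonDyer.BirchSwinnertonDyer.Theorems.LambdaTransportDoorAtTwoLayerTwoAlgebra

open Summit.BirchSwinnertonDyer.Rank2 Summit.BirchSwinnertonDyer.Rank2.Family81517
  Summit.BirchSwinnertonDyer.Rank2.LambdaTransportDoor
  Summit.BirchSwinnertonDyer.BirchSwinnertonDyer.Theorems.LambdaTransportDoorAtTwoLayerOne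

/-! ### §1. Linear algebra of a `ν₂`-eigenvector under the budget `dim V ≤ 4`, `dim ker A ≥ 2` -/

section LinearAlgebra

variable {K V : Type*} [Field K] [AddCommGroup V] [Module K V] [FiniteDimensional K V]

/-- **A `ν₂`-torsion vector exhausts the budget.** `K` a field with `2 ≠ 0` in which `c² + 2c + 2` has no root; `A`, `N`
endomorphisms of a finite-dimensional `V` with `N = A² + 2A + 2` pointwise, `dim V ≤ 4`, `dim ker A ≥ 2`, `ker N ≠ 0`. Then
`ker A² = ker A`, `dim ker A = 2`, `ker (A + 2) = 0`, `dim V = 4`, `dim ker N = 2`: a non-zero `w ∈ ker N` and `A w` are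
independent (else `A w = c w` with `ν₂(c) = 0`), `ker A ∩ ker N = 0` (`N = 2` on `ker A`), so `V = ker A ⊕ ker N`; on `ker N`,
`A² w = 0` forces `A w = −w`, `w = A² w = 0`, and `A w = −2w` forces `N w = 2w = 0`. [cite: Washington1997, §13.2 (Thm. 13.12)]
[cite: GreenbergLNM1716, §1 p. 65] -/
theorem layerTwo_linearAlgebra (A N : Module.End K V) (h2 : (2 : K) ≠ 0)
    (hK : ∀ c : K, c * c + 2 * c + 2 ≠ 0)
    (hN : ∀ v, N v = A (A v) + (2 : K) • A v + (2 : K) • v)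
    (hV : Module.finrank K V ≤ 4) (hkerA : 2 ≤ Module.finrank K (LinearMap.ker A))
    (hW : LinearMap.ker N ≠ ⊥) :
    LinearMap.ker (A * A) = LinearMap.ker A ∧ Module.finrank K (LinearMap.ker A) = 2 ∧
      LinearMap.ker (A + algebraMap K (Module.End K V) 2) = ⊥ ∧ Module.finrank K V = 4 ∧
      Module.finrank K (LinearMap.ker N) = 2 := by
  set W := LinearMap.ker N with hWdef
  -- `W` is `A`-stable
  have hAW : ∀ w ∈ W, A w ∈ W := fun w hw ↦ by
    rw [hWdef, LinearMap.mem_ker] at hw ⊢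
    rw [hN] at hw ⊢
    have : A (A (A w) + (2 : K) • A w + (2 : K) • w) = 0 := by rw [hw, map_zero]
    simpa only [map_add, map_smul] using this
  -- `ker A ⊓ W = ⊥`
  have hdisj : LinearMap.ker A ⊓ W = ⊥ := by
    rw [Submodule.eq_bot_iff]
    intro u hu
    obtain ⟨huA, huW⟩ := Submodule.mem_inf.mp hu
    rw [LinearMap.mem_ker] at huA
    rw [hWdef, LinearMap.mem_ker, hN, huA, map_zero, smul_zero, zero_add, zero_add] at huW
    exact (smul_eq_zero.mp huW).resolve_left h2
  -- `dim W ≥ 2`: a nonzero `w ∈ W` and `A w` are independent (`ν₂` has no root in `K`)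
  obtain ⟨w, hwW, hw0⟩ := (Submodule.ne_bot_iff W).mp hW
  have hli : LinearIndependent K ![w, A w] := by
    refine LinearIndependent.pair_iff.mpr fun s t hst ↦ ?_
    by_cases ht : t = 0
    · subst ht
      rw [zero_smul, add_zero] at hst
      exact ⟨(smul_eq_zero.mp hst).resolve_right hw0, rfl⟩
    · exfalso
      -- `A w = c • w` with `c = -s/t`
      have hAw : A w = (-s / t) • w := by
        have : t • A w = -(s • w) := eq_neg_of_add_eq_zero_right hst
        calc A w = t⁻¹ • (t • A w) := by rw [smul_smul, inv_mul_cancel₀ ht, one_smul]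
          _ = (-s / t) • w := by rw [this, smul_neg, smul_smul, ← neg_smul, neg_div, div_eq_inv_mul]
      have hNw : N w = 0 := by rwa [hWdef, LinearMap.mem_ker] at hwW
      rw [hN, hAw, map_smul, hAw, smul_smul, smul_smul, ← add_smul, ← add_smul] at hNw
      exact hK (-s / t) (by
        have := (smul_eq_zero.mp hNw).resolve_right hw0
        linear_combination this)
  have h2W : 2 ≤ Module.finrank K W := by
    have hspan : Submodule.span K (Set.range ![w, A w]) ≤ W := by
      rw [Submodule.span_le]
      rintro _ ⟨i, rfl⟩
      fin_cases i
      · exact hwW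
      · exact hAW w hwW
    calc 2 = Fintype.card (Fin 2) := (Fintype.card_fin 2).symm
      _ = Module.finrank K (Submodule.span K (Set.range ![w, A w])) := (finrank_span_eq_card hli).symm
      _ ≤ Module.finrank K W := Submodule.finrank_mono hspan
  -- dimension count
  have hsup := Submodule.finrank_sup_add_finrank_inf_eq (LinearMap.ker A) W
  rw [hdisj, finrank_bot, add_zero] at hsup
  have hle : Module.finrank K ↥(LinearMap.ker A ⊔ W) ≤ Module.finrank K V := Submodule.finrank_le _
  have hV4 : Module.finrank K V = 4 := by omega
  have hkA : Module.finrank K (LinearMap.ker A) = 2 := by omega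
  have hkW : Module.finrank K W = 2 := by omega
  have htop : LinearMap.ker A ⊔ W = ⊤ := Submodule.eq_top_of_finrank_eq (by omega)
  -- decomposition of a vector
  have hdec : ∀ v : V, ∃ u w', A u = 0 ∧ w' ∈ W ∧ v = u + w' := fun v ↦ by
    obtain ⟨u, hu, w', hw', huw⟩ := Submodule.mem_sup.mp (show v ∈ LinearMap.ker A ⊔ W by rw [htop]; trivial)
    exact ⟨u, w', LinearMap.mem_ker.mp hu, hw', huw.symm⟩
  have hNW : ∀ w' ∈ W, A (A w') + (2 : K) • A w' + (2 : K) • w' = 0 := fun w' hw' ↦ by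
    rw [← hN]; rwa [hWdef, LinearMap.mem_ker] at hw'
  refine ⟨?_, hkA, ?_, hV4, hkW⟩
  · -- semisimplicity at `T = 0`
    refine le_antisymm (fun v hv ↦ ?_) (fun v hv ↦ ?_)
    · rw [LinearMap.mem_ker, Module.End.mul_apply] at hv
      obtain ⟨u, w', hu, hw', rfl⟩ := hdec v
      rw [map_add, hu, zero_add] at hv
      -- from `ν₂(A) w' = 0` and `A² w' = 0`: `A w' = -w'`, then `w' = A² w' = 0`
      have h1 : (2 : K) • (A w' + w') = 0 := by
        have := hNW w' hw'
        rwa [hv, zero_add, ← smul_add] at this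
      have hAw' : A w' = -w' := eq_neg_of_add_eq_zero_left ((smul_eq_zero.mp h1).resolve_left h2)
      have hw0' : w' = 0 := by
        have : A (A w') = w' := by rw [hAw', map_neg, hAw', neg_neg]
        rw [← this, hv]
      rw [LinearMap.mem_ker, map_add, hu, hw0', map_zero, add_zero]
    · rw [LinearMap.mem_ker] at hv ⊢
      rw [Module.End.mul_apply, hv, map_zero]
  · -- no `-2`-eigenvector
    rw [Submodule.eq_bot_iff]
    intro v hv
    rw [LinearMap.mem_ker, LinearMap.add_apply, Module.algebraMap_end_apply] at hv
    obtain ⟨u, w', hu, hw', rfl⟩ := hdec v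
    rw [map_add, hu, zero_add, smul_add] at hv
    -- `A w' + 2 w' = -(2 u)` lies in `ker A ⊓ W = ⊥`
    have hmemW : A w' + (2 : K) • w' ∈ W := W.add_mem (hAW w' hw') (W.smul_mem _ hw')
    have hmemA : A w' + (2 : K) • w' ∈ LinearMap.ker A := by
      have heq : A w' + (2 : K) • w' = -((2 : K) • u) := by
        rw [eq_neg_iff_add_eq_zero, ← hv]; abel
      rw [heq, LinearMap.mem_ker, map_neg, map_smul, hu, smul_zero, neg_zero]
    have hzero : A w' + (2 : K) • w' = 0 := by
      have : A w' + (2 : K) • w' ∈ LinearMap.ker A ⊓ W := Submodule.mem_inf.mpr ⟨hmemA, hmemW⟩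
      rwa [hdisj, Submodule.mem_bot] at this
    have hu0 : u = 0 := by
      have h' : (2 : K) • u = 0 := by
        have h'' := hv
        rw [show A w' + ((2 : K) • u + (2 : K) • w') = (A w' + (2 : K) • w') + (2 : K) • u by abel, hzero,
          zero_add] at h''
        exact h''
      exact (smul_eq_zero.mp h').resolve_left h2
    have hAw' : A w' = -((2 : K) • w') := eq_neg_of_add_eq_zero_left hzero
    have hw0' : w' = 0 := by
      have h' := hNW w' hw'
      have e1 : A (A w') = ((2 : K) * 2) • w' := by
        rw [hAw', map_neg, map_smul, hAw', smul_neg, neg_neg, smul_smul]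
      have e2 : (2 : K) • A w' = -(((2 : K) * 2) • w') := by rw [hAw', smul_neg, smul_smul]
      rw [e1, e2, add_neg_cancel, zero_add] at h'
      exact (smul_eq_zero.mp h').resolve_left h2
    rw [hu0, hw0', add_zero]

end LinearAlgebra

/-! ### §2. `ν₂ = T² + 2T + 2` has no root in `ℚ_2` -/

/-- **`−1` is not a square in `ℚ_2`**: a square root would be a `2`-adic unit whose square is `−1` modulo `4`. (The same
statement is `Summit.Ventures.DiscreteObjects.UnitDistance.TwoAdic.sq_ne_neg_one` in another summit tree, not importable
here; re-proved.) [folklore] [cite: Washington1997, §13.1] -/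
theorem padicTwo_sq_ne_neg_one (x : ℚ_[2]) : x ^ 2 ≠ -1 := by
  intro hx
  have hnorm : ‖x‖ = 1 := by
    have h := congrArg norm hx
    rw [norm_pow, norm_neg, norm_one, pow_eq_one_iff_of_nonneg (norm_nonneg _) two_ne_zero] at h
    exact h
  set z : ℤ_[2] := ⟨x, hnorm.le⟩ with hz
  have hz2 : z ^ 2 = -1 := by
    apply Subtype.ext
    push_cast
    exact hx
  have h4 := congrArg (PadicInt.toZModPow 2) hz2
  rw [map_pow, map_neg, map_one] at h4
  revert h4
  generalize (PadicInt.toZModPow 2) z = y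
  decide +revert

/-- **`ν₂ = T² + 2T + 2` has no root in `ℚ_2`** (`ν₂(c) = (c+1)² + 1`). [folklore] [cite: Washington1997, §13.1] -/
theorem padicTwo_nu_ne_zero (c : ℚ_[2]) : c * c + 2 * c + 2 ≠ 0 := fun h ↦
  padicTwo_sq_ne_neg_one (c + 1) (by linear_combination h)

section LinAlg2
variable {K V : Type*} [Field K] [AddCommGroup V] [Module K V] [FiniteDimensional K V]

/-- **Coprime kernels**: `dim ker (pq)(A) = dim ker p(A) + dim ker q(A)` for coprime polynomials `p`, `q` and an endomorphism `A`
of a finite-dimensional vector space. [cite: Washington1997, §13.2] -/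
theorem finrank_ker_aeval_mul_of_isCoprime (A : Module.End K V) {p q : Polynomial K} (h : IsCoprime p q) :
    Module.finrank K (LinearMap.ker (Polynomial.aeval A (p * q))) =
      Module.finrank K (LinearMap.ker (Polynomial.aeval A p)) + Module.finrank K (LinearMap.ker (Polynomial.aeval A q)) := by
  have hsup := Polynomial.sup_ker_aeval_eq_ker_aeval_mul_of_coprime A h
  have hdis := Polynomial.disjoint_ker_aeval_of_isCoprime A h
  have hs := Submodule.finrank_sup_add_finrank_inf_eq (LinearMap.ker (Polynomial.aeval A p))
    (LinearMap.ker (Polynomial.aeval A q))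
  rw [hsup, hdis.eq_bot, finrank_bot, add_zero] at hs
  exact hs

/-- **`ω₁ = T(T+2)` and `ν₂ = T² + 2T + 2` are coprime** over any field with `2 ≠ 0` (Bezout: `ν₂ − ω₁ = 2`). [folklore]
[cite: Washington1997, §13.2] -/
theorem isCoprime_omega_one_nu_two (h2 : (2 : K) ≠ 0) :
    IsCoprime (Polynomial.X * (Polynomial.X + Polynomial.C (2 : K)))
      (Polynomial.X * Polynomial.X + Polynomial.C (2 : K) * Polynomial.X + Polynomial.C (2 : K)) := by
  refine ⟨-Polynomial.C (2⁻¹ : K), Polynomial.C (2⁻¹ : K), ?_⟩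
  have key : -Polynomial.C (2⁻¹ : K) * (Polynomial.X * (Polynomial.X + Polynomial.C (2 : K))) +
      Polynomial.C (2⁻¹ : K) * (Polynomial.X * Polynomial.X + Polynomial.C (2 : K) * Polynomial.X + Polynomial.C (2 : K)) =
      Polynomial.C (2⁻¹ * 2 : K) := by
    rw [map_mul]; ring
  rw [key, inv_mul_cancel₀ h2, map_one]

end LinAlg2

/-! ### §3. Module level (`Λ = ℤ_p⟦T⟧`, `ν₂` without root in `ℚ_p`) -/

section Module2

variable {p : ℕ} [Fact p.Prime] {M : Type u} [AddCommGroup M] [Module (IwasawaAlgebra p) M] [Module.Finite (IwasawaAlgebra p) M]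

/-- **`ω₂ = (1+T)^4 − 1 = T(T+2)(T² + 2T + 2)` in `ℤ_2⟦T⟧`** — the three cyclotomic factors seen by the layers `ℚ`,
`ℚ_1 = ℚ(√2)`, `ℚ_2 = ℚ(√(2+√2))`. [cite: Washington1997, §13.2 (`ω_n`)] -/
theorem omega_two_eq :
    ((1 + PowerSeries.X) ^ (2 ^ 2) - 1 : IwasawaAlgebra 2) =
      (PowerSeries.X * (PowerSeries.X + PowerSeries.C (2 : ℤ_[2]))) *
        (PowerSeries.X * PowerSeries.X + PowerSeries.C (2 : ℤ_[2]) * PowerSeries.X + PowerSeries.C (2 : ℤ_[2])) := by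
  rw [map_ofNat]; ring

/-- **CERTIFICATE C, MODULE FORM** (`Λ = ℤ_p⟦T⟧`, `ν₂ = T² + 2T + 2` without root in `ℚ_p` — e.g. `p = 2`). For a finitely
generated torsion `Λ`-module `X` with `λ(X) ≤ 4`, `rank_{ℤ_p} X/TX ≥ 2` and `rank_{ℤ_p} X/ν₂X ≥ 1`: `T` acts SEMISIMPLY on
`ℚ_p ⊗ X` (`ker T² = ker T`), `rank X/TX = 2`, `λ(X) = 4`, `rank X/(T+2)X = 0`, `rank X/ν₂X = 2` — §1 on `V = ℚ_p ⊗ X` via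
`rank_{ℤ_p} X/aX = dim ker(a | V)` (`…LayerOne.lambdaInvariant_quotient_eq_finrank_ker`). [cite: GreenbergLNM1716, §1 p. 65, Conj. 1.12]
[cite: Washington1997, §13.2 (Thm. 13.12, Prop. 13.8)] -/
theorem layerTwo_module (hK : ∀ c : ℚ_[p], c * c + 2 * c + 2 ≠ 0) (hM : Module.IsTorsion (IwasawaAlgebra p) M)
    (hl : lambdaInvariant p M ≤ 4)
    (hT : 2 ≤ coinvariantsRank p M)
    (hC : 1 ≤ lambdaInvariant p (M ⧸ (Ideal.span {(PowerSeries.X * PowerSeries.X + PowerSeries.C (2 : ℤ_[p]) * PowerSeries.X +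
        PowerSeries.C (2 : ℤ_[p]) : IwasawaAlgebra p)} • (⊤ : Submodule (IwasawaAlgebra p) M)))) :
    LinearMap.ker (mulTRat p M ∘ₗ mulTRat p M) = LinearMap.ker (mulTRat p M) ∧
      coinvariantsRank p M = 2 ∧ lambdaInvariant p M = 4 ∧
      lambdaInvariant p (M ⧸ (Ideal.span {(PowerSeries.X + PowerSeries.C (2 : ℤ_[p]) : IwasawaAlgebra p)} •
        (⊤ : Submodule (IwasawaAlgebra p) M))) = 0 ∧
      lambdaInvariant p (M ⧸ (Ideal.span {(PowerSeries.X * PowerSeries.X + PowerSeries.C (2 : ℤ_[p]) * PowerSeries.X +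
        PowerSeries.C (2 : ℤ_[p]) : IwasawaAlgebra p)} • (⊤ : Submodule (IwasawaAlgebra p) M))) = 2 := by
  letI : Module ℤ_[p] M := Module.compHom M (algebraMap ℤ_[p] (IwasawaAlgebra p))
  haveI : IsScalarTower ℤ_[p] (IwasawaAlgebra p) M := IsScalarTower.of_compHom ℤ_[p] _ _
  haveI : Module.Flat ℤ_[p] ℚ_[p] := IsLocalization.flat ℚ_[p] (nonZeroDivisors ℤ_[p])
  haveI : Module.Finite ℚ_[p] (ℚ_[p] ⊗[ℤ_[p]] M) := finite_baseChange_of_isTorsion p hM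
  let L : IwasawaAlgebra p → (M →ₗ[ℤ_[p]] M) := fun a ↦
    (DistribSMul.toLinearMap (IwasawaAlgebra p) M a).restrictScalars ℤ_[p]
  have hLmul : ∀ a b : IwasawaAlgebra p, L (a * b) = L a * L b := fun a b ↦ by
    ext x
    change (a * b) • x = a • b • x
    rw [mul_smul]
  have hLadd : ∀ a b : IwasawaAlgebra p, L (a + b) = L a + L b := fun a b ↦ by
    ext x
    change (a + b) • x = a • x + b • x
    rw [add_smul]
  have hLC : L (PowerSeries.C (2 : ℤ_[p])) = algebraMap ℤ_[p] (Module.End ℤ_[p] M) 2 := by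
    ext x
    rw [Module.algebraMap_end_apply]
    change (PowerSeries.C (2 : ℤ_[p]) : IwasawaAlgebra p) • x = (algebraMap ℤ_[p] (IwasawaAlgebra p) 2) • x
    rfl
  set A : Module.End ℚ_[p] (ℚ_[p] ⊗[ℤ_[p]] M) := (L PowerSeries.X).baseChange ℚ_[p] with hA
  have h2bc : (algebraMap ℤ_[p] (Module.End ℤ_[p] M) 2).baseChange ℚ_[p] =
      algebraMap ℚ_[p] (Module.End ℚ_[p] (ℚ_[p] ⊗[ℤ_[p]] M)) 2 := by
    rw [map_ofNat, map_ofNat, ← one_add_one_eq_two, LinearMap.baseChange_add, LinearMap.baseChange_one, one_add_one_eq_two]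
  have hA2 : (L (PowerSeries.X + PowerSeries.C (2 : ℤ_[p]))).baseChange ℚ_[p] =
      A + algebraMap ℚ_[p] (Module.End ℚ_[p] (ℚ_[p] ⊗[ℤ_[p]] M)) 2 := by
    rw [hLadd, LinearMap.baseChange_add, hLC, h2bc]
  set N : Module.End ℚ_[p] (ℚ_[p] ⊗[ℤ_[p]] M) := (L (PowerSeries.X * PowerSeries.X + PowerSeries.C (2 : ℤ_[p]) *
    PowerSeries.X + PowerSeries.C (2 : ℤ_[p]))).baseChange ℚ_[p] with hN
  have hNeq : N = A * A + algebraMap ℚ_[p] (Module.End ℚ_[p] (ℚ_[p] ⊗[ℤ_[p]] M)) 2 * A +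
      algebraMap ℚ_[p] (Module.End ℚ_[p] (ℚ_[p] ⊗[ℤ_[p]] M)) 2 := by
    rw [hN, hLadd, hLadd, hLmul, hLmul, LinearMap.baseChange_add, LinearMap.baseChange_add, LinearMap.baseChange_mul,
      LinearMap.baseChange_mul, hLC, h2bc]
  have hNA : ∀ v, N v = A (A v) + (2 : ℚ_[p]) • A v + (2 : ℚ_[p]) • v := fun v ↦ by
    rw [hNeq, LinearMap.add_apply, LinearMap.add_apply, Module.End.mul_apply, Module.End.mul_apply,
      Module.algebraMap_end_apply, Module.algebraMap_end_apply]
  -- the four ranks as dimensions on `V`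
  have hV : lambdaInvariant p M = Module.finrank ℚ_[p] (ℚ_[p] ⊗[ℤ_[p]] M) := lambdaInvariant_eq_finrank_tensorProduct M
  have hT' : coinvariantsRank p M = Module.finrank ℚ_[p] (LinearMap.ker A) := by
    rw [coinvariantsRank_eq_lambdaInvariant]
    exact lambdaInvariant_quotient_eq_finrank_ker hM (PowerSeries.X : IwasawaAlgebra p)
  have hX2 : lambdaInvariant p (M ⧸ (Ideal.span {(PowerSeries.X + PowerSeries.C (2 : ℤ_[p]) : IwasawaAlgebra p)} •
      (⊤ : Submodule (IwasawaAlgebra p) M))) =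
      Module.finrank ℚ_[p] (LinearMap.ker (A + algebraMap ℚ_[p] (Module.End ℚ_[p] (ℚ_[p] ⊗[ℤ_[p]] M)) 2)) := by
    rw [← hA2]
    exact lambdaInvariant_quotient_eq_finrank_ker hM (PowerSeries.X + PowerSeries.C (2 : ℤ_[p]) : IwasawaAlgebra p)
  have hNu : lambdaInvariant p (M ⧸ (Ideal.span {(PowerSeries.X * PowerSeries.X + PowerSeries.C (2 : ℤ_[p]) *
      PowerSeries.X + PowerSeries.C (2 : ℤ_[p]) : IwasawaAlgebra p)} • (⊤ : Submodule (IwasawaAlgebra p) M))) =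
      Module.finrank ℚ_[p] (LinearMap.ker N) :=
    lambdaInvariant_quotient_eq_finrank_ker hM _
  -- linear algebra
  obtain ⟨hss, hkA, hk2, hV4, hkN⟩ := layerTwo_linearAlgebra A N two_ne_zero hK hNA
    (by rw [← hV]; exact hl) (by rw [← hT']; exact hT) (by
      rw [ne_eq, ← Submodule.finrank_eq_zero, ← hNu]; omega)
  refine ⟨?_, by rw [hT', hkA], by rw [hV, hV4], by rw [hX2, hk2, finrank_bot], by rw [hNu, hkN]⟩
  exact hss

/-- **`rank_{ℤ_p} X/ω₁ν₂X = rank_{ℤ_p} X/ω₁X + rank_{ℤ_p} X/ν₂X`** (`ω₁ = T(T+2)`, `ν₂ = T² + 2T + 2`, coprime since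
`ν₂ − ω₁ = 2`) for a finitely generated torsion `Λ`-module `X`; at `p = 2` the left side is `rank_{ℤ_2} X/ω₂X`,
`ω₂ = (1+T)^4 − 1` (`omega_two_eq`), the `Γ^4`-coinvariant rank seen by the second layer `ℚ_2 = ℚ(√(2+√2))`.
[cite: GreenbergLNM1716, Thm. 1.2, §1 p. 65] [cite: Washington1997, §13.2 (`ω_n`)] -/
theorem lambdaInvariant_quotient_omega_one_mul_nu_two (hM : Module.IsTorsion (IwasawaAlgebra p) M) :
    lambdaInvariant p (M ⧸ (Ideal.span {((PowerSeries.X * (PowerSeries.X + PowerSeries.C (2 : ℤ_[p]))) *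
        (PowerSeries.X * PowerSeries.X + PowerSeries.C (2 : ℤ_[p]) * PowerSeries.X + PowerSeries.C (2 : ℤ_[p])) :
        IwasawaAlgebra p)} • (⊤ : Submodule (IwasawaAlgebra p) M))) =
      lambdaInvariant p (M ⧸ (Ideal.span {(PowerSeries.X * (PowerSeries.X + PowerSeries.C (2 : ℤ_[p])) :
        IwasawaAlgebra p)} • (⊤ : Submodule (IwasawaAlgebra p) M))) +
      lambdaInvariant p (M ⧸ (Ideal.span {(PowerSeries.X * PowerSeries.X + PowerSeries.C (2 : ℤ_[p]) * PowerSeries.X +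
        PowerSeries.C (2 : ℤ_[p]) : IwasawaAlgebra p)} • (⊤ : Submodule (IwasawaAlgebra p) M))) := by
  letI : Module ℤ_[p] M := Module.compHom M (algebraMap ℤ_[p] (IwasawaAlgebra p))
  haveI : IsScalarTower ℤ_[p] (IwasawaAlgebra p) M := IsScalarTower.of_compHom ℤ_[p] _ _
  haveI : Module.Flat ℤ_[p] ℚ_[p] := IsLocalization.flat ℚ_[p] (nonZeroDivisors ℤ_[p])
  haveI : Module.Finite ℚ_[p] (ℚ_[p] ⊗[ℤ_[p]] M) := finite_baseChange_of_isTorsion p hM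
  let L : IwasawaAlgebra p → (M →ₗ[ℤ_[p]] M) := fun a ↦
    (DistribSMul.toLinearMap (IwasawaAlgebra p) M a).restrictScalars ℤ_[p]
  have hLmul : ∀ a b : IwasawaAlgebra p, L (a * b) = L a * L b := fun a b ↦ by
    ext x
    change (a * b) • x = a • b • x
    rw [mul_smul]
  have hLadd : ∀ a b : IwasawaAlgebra p, L (a + b) = L a + L b := fun a b ↦ by
    ext x
    change (a + b) • x = a • x + b • x
    rw [add_smul]
  have hLC : L (PowerSeries.C (2 : ℤ_[p])) = algebraMap ℤ_[p] (Module.End ℤ_[p] M) 2 := by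
    ext x
    rw [Module.algebraMap_end_apply]
    change (PowerSeries.C (2 : ℤ_[p]) : IwasawaAlgebra p) • x = (algebraMap ℤ_[p] (IwasawaAlgebra p) 2) • x
    rfl
  set A : Module.End ℚ_[p] (ℚ_[p] ⊗[ℤ_[p]] M) := (L PowerSeries.X).baseChange ℚ_[p] with hA
  have h2bc : (algebraMap ℤ_[p] (Module.End ℤ_[p] M) 2).baseChange ℚ_[p] =
      algebraMap ℚ_[p] (Module.End ℚ_[p] (ℚ_[p] ⊗[ℤ_[p]] M)) 2 := by
    rw [map_ofNat, map_ofNat, ← one_add_one_eq_two, LinearMap.baseChange_add, LinearMap.baseChange_one, one_add_one_eq_two]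
  -- the two factors as polynomials in `A`
  set c2 := algebraMap ℚ_[p] (Module.End ℚ_[p] (ℚ_[p] ⊗[ℤ_[p]] M)) 2 with hc2
  have hB : (L (PowerSeries.X * (PowerSeries.X + PowerSeries.C (2 : ℤ_[p])))).baseChange ℚ_[p] =
      Polynomial.aeval A (Polynomial.X * (Polynomial.X + Polynomial.C (2 : ℚ_[p]))) := by
    rw [map_mul, map_add, Polynomial.aeval_X, Polynomial.aeval_C, hLmul, LinearMap.baseChange_mul, hLadd,
      LinearMap.baseChange_add, hLC, h2bc]
  have hN : (L (PowerSeries.X * PowerSeries.X + PowerSeries.C (2 : ℤ_[p]) * PowerSeries.X +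
      PowerSeries.C (2 : ℤ_[p]))).baseChange ℚ_[p] =
      Polynomial.aeval A (Polynomial.X * Polynomial.X + Polynomial.C (2 : ℚ_[p]) * Polynomial.X + Polynomial.C (2 : ℚ_[p])) := by
    rw [map_add, map_add, map_mul, map_mul, Polynomial.aeval_X, Polynomial.aeval_C, hLadd, hLadd, hLmul, hLmul,
      LinearMap.baseChange_add, LinearMap.baseChange_add, LinearMap.baseChange_mul, LinearMap.baseChange_mul, hLC, h2bc]
  have hBN : (L ((PowerSeries.X * (PowerSeries.X + PowerSeries.C (2 : ℤ_[p]))) *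
      (PowerSeries.X * PowerSeries.X + PowerSeries.C (2 : ℤ_[p]) * PowerSeries.X + PowerSeries.C (2 : ℤ_[p])))).baseChange ℚ_[p] =
      Polynomial.aeval A ((Polynomial.X * (Polynomial.X + Polynomial.C (2 : ℚ_[p]))) *
        (Polynomial.X * Polynomial.X + Polynomial.C (2 : ℚ_[p]) * Polynomial.X + Polynomial.C (2 : ℚ_[p]))) := by
    rw [map_mul, ← hB, ← hN, hLmul, LinearMap.baseChange_mul]
  have h1 := lambdaInvariant_quotient_eq_finrank_ker hM ((PowerSeries.X * (PowerSeries.X + PowerSeries.C (2 : ℤ_[p]))) *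
      (PowerSeries.X * PowerSeries.X + PowerSeries.C (2 : ℤ_[p]) * PowerSeries.X + PowerSeries.C (2 : ℤ_[p])))
  have h2 := lambdaInvariant_quotient_eq_finrank_ker hM (PowerSeries.X * (PowerSeries.X + PowerSeries.C (2 : ℤ_[p])))
  have h3 := lambdaInvariant_quotient_eq_finrank_ker hM (PowerSeries.X * PowerSeries.X + PowerSeries.C (2 : ℤ_[p]) *
    PowerSeries.X + PowerSeries.C (2 : ℤ_[p]))
  change lambdaInvariant p _ = Module.finrank ℚ_[p] (LinearMap.ker ((L _).baseChange ℚ_[p])) at h1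
  change lambdaInvariant p _ = Module.finrank ℚ_[p] (LinearMap.ker ((L _).baseChange ℚ_[p])) at h2
  change lambdaInvariant p _ = Module.finrank ℚ_[p] (LinearMap.ker ((L _).baseChange ℚ_[p])) at h3
  rw [hBN] at h1
  rw [hB] at h2
  rw [hN] at h3
  rw [h1, h2, h3]
  exact finrank_ker_aeval_mul_of_isCoprime A (isCoprime_omega_one_nu_two (K := ℚ_[p]) two_ne_zero)

end Module2

end Summit.BirchSwinnertonDyer.BirchSwinnertonDyer.Theorems.LambdaTransportDoorAtTwoLayerTwoAlgebra
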